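import Summits.CriticalPhenomena.PercolationContinuityZ3.Theorems.PercNearOneGluingNoHeavyQuantFarSunSharpLargeK
import HarnessLib

/-!
# FAR beyond trees: the POISSON-RATIO lower-tail bound for a Poisson-binomial count (`P(S ≤ c) ≤ γ/(γ + Σ_t U^t c!/(c+t)!)`,
# `γ = U/(U−c)`) and the deficit of a closed hair in this form — sharper than Chernoff at small layers

builds on p205010 (kernel theorem, internal audit signed; external expert review pending)

Support file (`--supports stmt-CriticalPhenomena-4575`), seat `prim-cert-1` (gen 42); memo `prim-cert-1/FROM-prim-cert-1-g42-SHARP-LARGEK.md` §2.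
From the ratio bound `U·P(S = b−1) ≤ b·P(S = b)` (`1 ≤ b ≤ U = E S`, `Quant.CountDP.PB_ratio`) for the success count `S` of independent trials:
* `Quant.CountDP.PB_mul_pow_le` — upward: `P(S = c)·U^t·c! ≤ P(S = c+t)·(c+t)!` for `c + t ≤ U`;
* `Quant.CountDP.PB_tail_mul_le` — `(U − b)·P(S ≤ b) ≤ U·P(S = b)` for `b ≤ U` (the recursion form of `Quant.pb_tail_le_atom_aux`);
* **`Quant.CountDP.PB_tail_le_ratio`** — for `c < U₀ ≤ U` and `c + n ≤ U₀`:
  `P(S ≤ c) ≤ γ₀/(S₀ + γ₀)`, `γ₀ = U₀/(U₀ − c)`, `S₀ = Σ_{t<n} U₀^{t+1} c!/(c+t+1)!` (the mass above `c` is at least `P(S = c)·S₀`);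
* **`HairyCycle.noWit_erase_le_ratio`** — through the bridge `sum_hairW_count_eq_PB`: for `0 ≤ h ≤ 1` (everywhere), `k < K`, `h⁰ = update h k 0`,
  `2j < U₀ ≤ Σ_{i<K} h i − 1` and `2j + n ≤ U₀`:  `Σ_{Q ⊆ range K ∖ {k}} hairW K h⁰ Q·𝟙[wit j Q = ∅] ≤ γ₀/(S₀ + γ₀)` with `c = 2j`.
At layer `3` with `U₀ = 65/4`, `n = 10` this gives `0.0066` where Chernoff (`noWit_erase_le_chernoff`) gives `0.012`.
No definitions, no sorries, standard axioms.  Elementary [this work].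
-/

noncomputable section

namespace Summit.CriticalPhenomena.PercolationContinuityZ3.Theorems

namespace Quant

namespace CountDP

open Finset

/-- `PB[p, m] b` = probability that exactly `b` of the first `m` independent trials succeed (recursion on `m`, as in `…QuantCountDP.lean`). -/
local notation3 "PB[" p ", " m "]" =>
  (Nat.rec (motive := fun _ => ℕ → ℝ) (fun b => if b = 0 then (1 : ℝ) else 0)
    (fun n f b => (p : ℕ → ℝ) n * (if b = 0 then (0 : ℝ) else f (b - 1)) + (1 - (p : ℕ → ℝ) n) * f b) (m : ℕ))

variable (p : ℕ → ℝ)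

/-- **Upward ratio bound**: `P(S = c)·U^t·c! ≤ P(S = c+t)·(c+t)!` whenever `c + t ≤ U = Σ_{k<m} p k` (`p ∈ [0,1]`). [this work] -/
theorem PB_mul_pow_le (hp : ∀ k, 0 ≤ p k ∧ p k ≤ 1) (m c : ℕ) :
    ∀ t : ℕ, ((c + t : ℕ) : ℝ) ≤ ∑ k ∈ Finset.range m, p k →
      PB[p, m] c * (∑ k ∈ Finset.range m, p k) ^ t * (c.factorial : ℝ) ≤ PB[p, m] (c + t) * ((c + t).factorial : ℝ) := by
  intro t
  induction t with
  | zero => intro _; simp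
  | succ t ih =>
    intro hct
    set U := ∑ k ∈ Finset.range m, p k with hU
    have hct' : ((c + t : ℕ) : ℝ) ≤ U := by
      have : ((c + t : ℕ) : ℝ) ≤ ((c + (t + 1) : ℕ) : ℝ) := by exact_mod_cast (by omega : c + t ≤ c + (t + 1))
      linarith
    have h1 := ih hct'
    have hr := PB_ratio p hp m (c + t + 1) (by omega) (by
      have : ((c + t + 1 : ℕ) : ℝ) = ((c + (t + 1) : ℕ) : ℝ) := by push_cast; ring
      rw [this]; exact hct)
    have hsub : c + t + 1 - 1 = c + t := by omega
    rw [hsub] at hr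
    have hU0 : 0 ≤ U := Finset.sum_nonneg fun k _ => (hp k).1
    have hfac0 : (0 : ℝ) ≤ ((c + t).factorial : ℝ) := Nat.cast_nonneg _
    have e2 : (((c + (t + 1)).factorial : ℕ) : ℝ) = ((c : ℝ) + t + 1) * ((c + t).factorial : ℝ) := by
      rw [show c + (t + 1) = c + t + 1 by ring, Nat.factorial_succ]; push_cast; ring
    rw [e2, show c + (t + 1) = c + t + 1 by ring]
    push_cast at hr
    have h2 : PB[p, m] c * U ^ t * (c.factorial : ℝ) * U ≤ PB[p, m] (c + t) * ((c + t).factorial : ℝ) * U :=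
      mul_le_mul_of_nonneg_right h1 hU0
    have h4 : U * PB[p, m] (c + t) * ((c + t).factorial : ℝ) ≤ ((c : ℝ) + t + 1) * PB[p, m] (c + t + 1) * ((c + t).factorial : ℝ) :=
      mul_le_mul_of_nonneg_right hr hfac0
    calc PB[p, m] c * U ^ (t + 1) * (c.factorial : ℝ) = PB[p, m] c * U ^ t * (c.factorial : ℝ) * U := by ring
      _ ≤ PB[p, m] (c + t) * ((c + t).factorial : ℝ) * U := h2
      _ = U * PB[p, m] (c + t) * ((c + t).factorial : ℝ) := by ring
      _ ≤ ((c : ℝ) + t + 1) * PB[p, m] (c + t + 1) * ((c + t).factorial : ℝ) := h4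
      _ = PB[p, m] (c + t + 1) * (((c : ℝ) + t + 1) * ((c + t).factorial : ℝ)) := by ring

/-- **Tail-to-atom bound**: `(U − b)·P(S ≤ b) ≤ U·P(S = b)` for `b ≤ U = Σ_{k<m} p k` (`p ∈ [0,1]`). [this work] -/
theorem PB_tail_mul_le (hp : ∀ k, 0 ≤ p k ∧ p k ≤ 1) (m : ℕ) :
    ∀ b : ℕ, (b : ℝ) ≤ ∑ k ∈ Finset.range m, p k →
      (∑ k ∈ Finset.range m, p k - b) * ∑ i ∈ Finset.range (b + 1), PB[p, m] i ≤ (∑ k ∈ Finset.range m, p k) * PB[p, m] b := by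
  intro b
  induction b with
  | zero => intro _; simp
  | succ b ih =>
    intro hb
    set U := ∑ k ∈ Finset.range m, p k with hU
    have hb' : (b : ℝ) ≤ U := by
      have : ((b : ℕ) : ℝ) ≤ ((b + 1 : ℕ) : ℝ) := by exact_mod_cast (by omega : b ≤ b + 1)
      linarith
    have h1 := ih hb'
    have hr := PB_ratio p hp m (b + 1) (by omega) hb
    rw [Nat.add_sub_cancel] at hr
    have hT0 : 0 ≤ ∑ i ∈ Finset.range (b + 1), PB[p, m] i := cdf_nonneg p hp m (b + 1)
    have hP0 : 0 ≤ PB[p, m] (b + 1) := PB_nonneg p hp m (b + 1)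
    rw [Finset.sum_range_succ]
    push_cast
    have h2 : (U - (b + 1)) * ∑ i ∈ Finset.range (b + 1), PB[p, m] i ≤ (U - b) * ∑ i ∈ Finset.range (b + 1), PB[p, m] i := by
      nlinarith
    push_cast at hr
    nlinarith

/-- **The Poisson-ratio lower-tail bound.**  For `p ∈ [0,1]`, `U = Σ_{k<m} p k`, reals `U₀` with `c < U₀ ≤ U` and `c + n ≤ U₀`:
`P(S ≤ c) ≤ γ₀/(S₀ + γ₀)` with `γ₀ = U₀/(U₀ − c)` and `S₀ = Σ_{t<n} U₀^{t+1}·c!/(c+t+1)!`. [this work] -/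
theorem PB_tail_le_ratio (hp : ∀ k, 0 ≤ p k ∧ p k ≤ 1) (m c n : ℕ) {U₀ : ℝ} (hc : (c : ℝ) < U₀)
    (hU₀ : U₀ ≤ ∑ k ∈ Finset.range m, p k) (hn : ((c + n : ℕ) : ℝ) ≤ U₀) :
    ∑ i ∈ Finset.range (c + 1), PB[p, m] i ≤
      (U₀ / (U₀ - c)) / (∑ t ∈ Finset.range n, U₀ ^ (t + 1) * (c.factorial : ℝ) / ((c + t + 1).factorial : ℝ) + U₀ / (U₀ - c)) := by
  set U := ∑ k ∈ Finset.range m, p k with hU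
  set T := ∑ i ∈ Finset.range (c + 1), PB[p, m] i with hT
  set γ₀ := U₀ / (U₀ - c) with hγ
  set S₀ := ∑ t ∈ Finset.range n, U₀ ^ (t + 1) * (c.factorial : ℝ) / ((c + t + 1).factorial : ℝ) with hS
  have hU₀0 : 0 < U₀ := lt_of_le_of_lt (Nat.cast_nonneg c) hc
  have hγpos : 0 < γ₀ := div_pos hU₀0 (by linarith)
  have hS0 : 0 ≤ S₀ := Finset.sum_nonneg fun t _ => by positivity
  have hT0 : 0 ≤ T := cdf_nonneg p hp m (c + 1)
  have hPc0 : 0 ≤ PB[p, m] c := PB_nonneg p hp m c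
  have hcU : (c : ℝ) ≤ U := by linarith
  -- `T ≤ γ₀ · P(S = c)`
  have h1 : T ≤ γ₀ * PB[p, m] c := by
    have ha := PB_tail_mul_le p hp m c hcU
    rw [← hU, ← hT] at ha
    -- `T (U − c) ≤ U P_c` and `U/(U−c) ≤ U₀/(U₀−c)`
    have hUc : 0 < U - c := by linarith
    have h2 : T ≤ U * PB[p, m] c / (U - c) := by rw [le_div_iff₀ hUc]; linarith
    have h3 : U * PB[p, m] c / (U - c) ≤ γ₀ * PB[p, m] c := by
      rw [hγ, div_le_iff₀ hUc]
      have h4 : U₀ / (U₀ - c) * PB[p, m] c * (U - c) = PB[p, m] c * (U₀ * (U - c) / (U₀ - c)) := by ring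
      rw [h4]
      have h5 : U ≤ U₀ * (U - c) / (U₀ - c) := by
        rw [le_div_iff₀ (by linarith)]; nlinarith
      nlinarith
    exact h2.trans h3
  -- `P(S = c) · S₀ ≤ 1 − T`
  have h2 : PB[p, m] c * S₀ ≤ 1 - T := by
    -- termwise: `P_c U₀^{t+1} c!/(c+t+1)! ≤ P_{c+t+1}`
    have hterm : ∀ t ∈ Finset.range n, PB[p, m] c * (U₀ ^ (t + 1) * (c.factorial : ℝ) / ((c + t + 1).factorial : ℝ)) ≤ PB[p, m] (c + (t + 1)) := by
      intro t ht
      rw [Finset.mem_range] at ht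
      have hct : ((c + (t + 1) : ℕ) : ℝ) ≤ U := by
        have : ((c + (t + 1) : ℕ) : ℝ) ≤ ((c + n : ℕ) : ℝ) := by exact_mod_cast (by omega : c + (t + 1) ≤ c + n)
        linarith
      have hup := PB_mul_pow_le p hp m c (t + 1) hct
      rw [← hU] at hup
      have hfac : (0 : ℝ) < ((c + t + 1).factorial : ℝ) := by exact_mod_cast Nat.factorial_pos _
      have hpow : U₀ ^ (t + 1) ≤ U ^ (t + 1) := pow_le_pow_left₀ hU₀0.le hU₀ _
      have e : c + (t + 1) = c + t + 1 := by ring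
      rw [e] at hup ⊢
      rw [show PB[p, m] c * (U₀ ^ (t + 1) * (c.factorial : ℝ) / ((c + t + 1).factorial : ℝ)) =
          PB[p, m] c * U₀ ^ (t + 1) * (c.factorial : ℝ) / ((c + t + 1).factorial : ℝ) by ring, div_le_iff₀ hfac]
      have h3 : PB[p, m] c * U₀ ^ (t + 1) * (c.factorial : ℝ) ≤ PB[p, m] c * U ^ (t + 1) * (c.factorial : ℝ) :=
        mul_le_mul_of_nonneg_right (mul_le_mul_of_nonneg_left hpow hPc0) (Nat.cast_nonneg _)
      exact h3.trans hup
    have hsum : PB[p, m] c * S₀ ≤ ∑ t ∈ Finset.range n, PB[p, m] (c + (t + 1)) := by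
      rw [hS, Finset.mul_sum]
      exact Finset.sum_le_sum hterm
    -- the masses at `0..c` and `c+1..c+n` add up to at most one
    have hcn : c + 1 + n ≤ m + 1 := by
      have hUm : U ≤ m := by
        have := Finset.sum_le_sum (s := Finset.range m) (f := p) (g := fun _ => (1 : ℝ)) fun k _ => (hp k).2
        simpa using this
      have h' : ((c + n : ℕ) : ℝ) ≤ (m : ℝ) := by linarith
      have h'' : c + n ≤ m := by exact_mod_cast h'
      omega
    have htot : T + ∑ t ∈ Finset.range n, PB[p, m] (c + (t + 1)) ≤ 1 := by
      have e : T + ∑ t ∈ Finset.range n, PB[p, m] (c + (t + 1)) = ∑ i ∈ Finset.range (c + 1 + n), PB[p, m] i := by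
        rw [hT, Finset.sum_range_add (fun i => PB[p, m] i) (c + 1) n]
        congr 1
        exact Finset.sum_congr rfl fun t _ => by rw [show c + (t + 1) = c + 1 + t by ring]
      rw [e]
      exact (Finset.sum_le_sum_of_subset_of_nonneg (Finset.range_mono hcn) fun i _ _ => PB_nonneg p hp m i).trans
        (le_of_eq (PB_sum_eq_one p m))
    linarith
  -- combine
  have h3 : T * (S₀ + γ₀) ≤ γ₀ := by
    have : T * S₀ ≤ γ₀ * PB[p, m] c * S₀ := mul_le_mul_of_nonneg_right h1 hS0
    nlinarith
  rw [le_div_iff₀ (by linarith)]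
  exact h3

end CountDP

end Quant

namespace HairyCycle

open Finset
open scoped Classical

variable {K : ℕ}

/-- `PB[p, m] b` (as above). -/
local notation3 "PB[" p ", " m "]" =>
  (Nat.rec (motive := fun _ => ℕ → ℝ) (fun b => if b = 0 then (1 : ℝ) else 0)
    (fun n f b => (p : ℕ → ℝ) n * (if b = 0 then (0 : ℝ) else f (b - 1)) + (1 - (p : ℕ → ℝ) n) * f b) (m : ℕ))

/-- **No-witness mass avoiding `k`, Poisson-ratio form.**  For `0 ≤ h ≤ 1` (everywhere), `k < K`, `h⁰ = update h k 0`, a real `U₀` with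
`2j < U₀ ≤ Σ_{i<K} h i − 1` and a natural `n` with `2j + n ≤ U₀`:
`Σ_{Q ⊆ range K ∖ {k}} hairW K h⁰ Q·𝟙[wit j Q = ∅] ≤ γ₀/(S₀ + γ₀)`, `γ₀ = U₀/(U₀ − 2j)`, `S₀ = Σ_{t<n} U₀^{t+1} (2j)!/(2j+t+1)!`. [this work] -/
theorem noWit_erase_le_ratio {h : ℕ → ℝ} (hh : ∀ i, 0 ≤ h i ∧ h i ≤ 1) (j : ℕ) {k : ℕ} (hk : k < K) (n : ℕ) {U₀ : ℝ}
    (hc : (2 * j : ℝ) < U₀) (hU₀ : U₀ ≤ ∑ i ∈ range K, h i - 1) (hn : ((2 * j + n : ℕ) : ℝ) ≤ U₀) :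
    ∑ Q ∈ ((range K).erase k).powerset, hairW K (Function.update h k 0) Q * (if (wit j Q).Nonempty then (0 : ℝ) else 1) ≤
      (U₀ / (U₀ - 2 * j)) /
        (∑ t ∈ Finset.range n, U₀ ^ (t + 1) * ((2 * j).factorial : ℝ) / ((2 * j + t + 1).factorial : ℝ) + U₀ / (U₀ - 2 * j)) := by
  set h0 := Function.update h k 0 with hh0def
  have hh0 : ∀ i, 0 ≤ h0 i ∧ h0 i ≤ 1 := by
    intro i
    by_cases hik : i = k
    · rw [hik, hh0def, Function.update_self]; norm_num
    · rw [hh0def, Function.update_of_ne hik]; exact hh i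
  have hh0' : ∀ i, i < K → 0 ≤ h0 i ∧ h0 i ≤ 1 := fun i _ => hh0 i
  -- no witness ⟹ at most `2j` members; extend to all patterns
  have h1 : ∑ Q ∈ ((range K).erase k).powerset, hairW K h0 Q * (if (wit j Q).Nonempty then (0 : ℝ) else 1) ≤
      ∑ Q ∈ ((range K).erase k).powerset, hairW K h0 Q * (if (Q ∩ range K).card ≤ 2 * j then (1 : ℝ) else 0) := by
    refine Finset.sum_le_sum fun Q _ => mul_le_mul_of_nonneg_left ?_ (hairW_nonneg hh0' Q)
    by_cases hne : (wit j Q).Nonempty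
    · rw [if_pos hne]; split_ifs <;> norm_num
    · have hcQ : Q.card ≤ 2 * j := card_le_of_wit_not_nonempty hne
      have hc1 : (Q ∩ range K).card ≤ 2 * j := (Finset.card_le_card Finset.inter_subset_left).trans hcQ
      rw [if_neg hne, if_pos hc1]
  have h2 : ∑ Q ∈ ((range K).erase k).powerset, hairW K h0 Q * (if (Q ∩ range K).card ≤ 2 * j then (1 : ℝ) else 0) ≤
      ∑ Q ∈ (range K).powerset, hairW K h0 Q * (if (Q ∩ range K).card ≤ 2 * j then (1 : ℝ) else 0) :=
    Finset.sum_le_sum_of_subset_of_nonneg (Finset.powerset_mono.2 (Finset.erase_subset k (range K))) fun Q _ _ =>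
      mul_nonneg (hairW_nonneg hh0' Q) (by split_ifs <;> norm_num)
  -- bridge to the success count of the trials `h⁰ ∘ nth`
  set cnt := Nat.count (· ∈ range K) K with hcnt
  set q : ℕ → ℝ := fun i => h0 (Nat.nth (· ∈ range K) i) with hq
  have hqq : ∀ i, 0 ≤ q i ∧ q i ≤ 1 := nth_trials_mem hh0 (range K)
  have hbridge := sum_hairW_count_eq_PB h0 (range K) K (fun b => if b ≤ 2 * j then (1 : ℝ) else 0)
  have h3 : ∑ b ∈ range (cnt + 1), PB[q, cnt] b * (if b ≤ 2 * j then (1 : ℝ) else 0) ≤ ∑ i ∈ range (2 * j + 1), PB[q, cnt] i := by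
    calc ∑ b ∈ range (cnt + 1), PB[q, cnt] b * (if b ≤ 2 * j then (1 : ℝ) else 0)
        = ∑ b ∈ range (cnt + 1), (if b ≤ 2 * j then PB[q, cnt] b else 0) :=
          Finset.sum_congr rfl fun b _ => by split_ifs <;> simp
      _ = ∑ b ∈ (range (cnt + 1)).filter (fun b => b ≤ 2 * j), PB[q, cnt] b := (Finset.sum_filter _ _).symm
      _ ≤ ∑ i ∈ range (2 * j + 1), PB[q, cnt] i := by
          refine Finset.sum_le_sum_of_subset_of_nonneg (fun b hb => ?_) fun i _ _ => Quant.CountDP.PB_nonneg q hqq cnt i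
          rw [Finset.mem_filter] at hb
          rw [Finset.mem_range]; omega
  -- the mean of the trials is `Σ − h k ≥ U₀`
  have hmean : ∑ i ∈ range cnt, q i = ∑ i ∈ range K, h i - h k := by
    rw [hq, hcnt, sum_nth_eq_sum_filter h0 (range K) K]
    have hf : (range K).filter (fun i => i ∈ range K) = range K := by ext i; simp
    rw [hf, hh0def, Finset.sum_update_of_mem (Finset.mem_range.2 hk), Finset.sdiff_singleton_eq_erase]
    have := Finset.add_sum_erase (range K) h (Finset.mem_range.2 hk)
    linarith
  have hU : U₀ ≤ ∑ i ∈ range cnt, q i := by rw [hmean]; linarith [(hh k).2]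
  have h4 := Quant.CountDP.PB_tail_le_ratio q hqq cnt (2 * j) n (by push_cast; exact hc) hU hn
  push_cast at h4
  calc ∑ Q ∈ ((range K).erase k).powerset, hairW K h0 Q * (if (wit j Q).Nonempty then (0 : ℝ) else 1)
      ≤ ∑ Q ∈ (range K).powerset, hairW K h0 Q * (if (Q ∩ range K).card ≤ 2 * j then (1 : ℝ) else 0) := h1.trans h2
    _ = ∑ b ∈ range (cnt + 1), PB[q, cnt] b * (if b ≤ 2 * j then (1 : ℝ) else 0) := hbridge
    _ ≤ ∑ i ∈ range (2 * j + 1), PB[q, cnt] i := h3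
    _ ≤ _ := h4

end HairyCycle

end Summit.CriticalPhenomena.PercolationContinuityZ3.Theorems

end
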